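import Mathlib.CategoryTheory.Limits.Shapes.Biproducts
import Mathlib.CategoryTheory.Limits.Shapes.BinaryBiproducts
import Mathlib.CategoryTheory.Linear.Basic
import Mathlib.RingTheory.Artinian.Module
import Mathlib.RingTheory.FiniteLength
import HarnessLib

/-!
# The bi-chain condition (Atiyah 1956, §3; Krause, *Krull–Schmidt categories and projective covers*, §5 «Chain conditions»)

Topic `Literature/CategoryTheory/Preadditive`, namespace `Literature.CategoryTheory.KrullSchmidt` (the namespace of the sibling Krull–Schmidt
files `IndecomposableLocalEnd`, `KrullSchmidtObjects`, `Radical`, …).  First file of the CHAIN-CONDITIONS story (Atiyah 1956 = Krause 2015 §5):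
the bi-chain condition itself, its inheritance by direct summands, the Hopf property it forces, Atiyah's Lemma 3 and Krause's Lemma 5.2 ∕
Atiyah's Corollary (`Hom`-finite objects satisfy it).  Lemma 5.1 (finite length), Lemma 5.3 (Fitting), Prop. 5.4 and Thm. 5.5 (Atiyah's
Theorem 1) follow in sibling files.  Pure category theory over Mathlib; everything proved; one structure (`Bichain`), two `Prop`-valued
definitions (`Bichain.EventuallyIso`, `BichainCondition`) and five auxiliary definitions with bodies (`Bichain.cons`, `Bichain.const`,
`Bichain.fwdComp`∕`bwdComp`, `Bichain.endStep`, `Bichain.endTransfer`); no named fact, no instance, no notation.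

## The sources, verbatim

Atiyah [Atiyah1956, §3 «Chain conditions»]: «DEFINITION. A *bi-chain* of `𝔄` is a sequence of triples `{Aₙ, iₙ, pₙ}` with the following
properties: (i) `Aₙ ∈ 𝔄` (`n ≥ 0`), (ii) `iₙ : Aₙ → Aₙ₋₁` is a monomorphism (`n ≥ 1`), (ii)* `pₙ : Aₙ₋₁ → Aₙ` is an epimorphism (`n ≥ 1`).
DEFINITION. A bi-chain `{Aₙ, iₙ, pₙ}` is said to *terminate* if there exists an integer `N` such that, for all `n ≥ N`, `iₙ` and `pₙ` are
equivalences.  DEFINITION. The *bi-chain condition* holds in `𝔄` if every bi-chain of `𝔄` terminates. … `H(pₙ, iₙ) : H(Aₙ,Aₙ) → H(Aₙ₋₁,Aₙ₋₁)`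
is a monomorphism. Thus `{H(Aₙ,Aₙ), H(pₙ,iₙ)}` is a descending chain of abelian groups. We say that such a descending chain terminates if
`H(pₙ,iₙ)` is an isomorphism for all sufficiently large `n`.  LEMMA 3. Let `{Aₙ, iₙ, pₙ}` be a bi-chain of `𝔄`. Then `{Aₙ, iₙ, pₙ}` terminates
if and only if the descending chain `{H(Aₙ,Aₙ), H(pₙ,iₙ)}` terminates.  *Proof.* … Conversely suppose that, for `n ≥ N`, `H(pₙ,iₙ)` is an
isomorphism. Then, for some `φ : Aₙ → Aₙ`, we must have `e_{Aₙ₋₁} = iₙ φ pₙ`; but this implies that `iₙ` is an epimorphism and `pₙ` a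
monomorphism. Hence both are equivalences.  COROLLARY. Let `𝔄` be an exact category with the further structure: a. For all pairs `A, B ∈ 𝔄`,
`H(A,B)` is a finite-dimensional vector space over a field `k`; b. For all pairs `φ, ψ ∈ 𝔄`, `H(φ,ψ)` is a `k`-homomorphism. Then the
bi-chain condition holds in `𝔄`.»
Krause [Krause2015KS, §5]: «A *bi-chain* in a category is a sequence of morphisms `Xₙ —αₙ→ Xₙ₊₁ —βₙ→ Xₙ` (`n ≥ 0`) such that `αₙ` is an
epimorphism and `βₙ` is a monomorphism for all integers `n ≥ 0`. The object `X` satisfies the *bi-chain condition* if for every bi-chain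
`Xₙ —αₙ→ Xₙ₊₁ —βₙ→ Xₙ` (`n ≥ 0`) with `X = X₀` there exists an integer `n₀` such that `αₙ` and `βₙ` are invertible for all `n ≥ n₀`.»
«An additive category `𝒜` is *Hom-finite* if there exists a commutative ring `k` such that `Hom_𝒜(X,Y)` is a `k`-module of finite length
for all objects `X, Y` and the composition maps are `k`-bilinear.»  **Lemma 5.2.** «An object of a Hom-finite abelian category satisfies the
bi-chain condition.  *Proof.* … Each pair `αₙ, βₙ` induces a monomorphism `Hom_𝒜(Xₙ₊₁,Xₙ₊₁) → Hom_𝒜(Xₙ,Xₙ)`. If this map is bijective, then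
`αₙ` is a monomorphism and `βₙ` is an epimorphism. In an abelian category, any morphism is invertible if it is both a monomorphism and an
epimorphism. Thus the assumption on `𝒜` implies that `αₙ` and `βₙ` are invertible for large enough `n`.»  Proof of **Theorem 5.5**: «It
remains to observe that any direct summand of `X` satisfies the bi-chain condition.»

## What is formalised (any category `C`; `k`-linear for §5)

* §1 `Bichain C` (objects `obj n`, epimorphisms `fwd n : obj n ⟶ obj (n+1)` = Krause's `αₙ` = Atiyah's `pₙ₊₁`, monomorphisms
  `bwd n : obj (n+1) ⟶ obj n` = `βₙ` = `iₙ₊₁`), `Bichain.EventuallyIso` («terminates»), the constructions `cons` (prepend `X —a→ X₀ —b→ X`),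
  `const` (the constant bi-chain of an epi∕mono pair of endomorphisms), the composites `fwdComp n : obj 0 ⟶ obj n` (epi) and
  `bwdComp n : obj n ⟶ obj 0` (mono).
* §2 **`BichainCondition X`** — Krause's object-wise definition, with «`X = X₀`» read as `X ≅ X₀`; invariance under isomorphism (`of_iso`,
  `iff_of_iso`); **direct summands inherit it**: retracts (`of_retract`), binary and finite biproduct summands (`of_iso_biprod_left∕right`,
  `of_iso_biproduct`) — the observation closing the proof of Thm. 5.5; zero objects satisfy it (`of_isZero`).
* §3 consequences recorded for the sequel (immediate from the constant bi-chains `X —φ→ X —𝟙→ X` and `X —𝟙→ X —φ→ X`): an object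
  satisfying the bi-chain condition is HOPFIAN and CO-HOPFIAN — epimorphic or monomorphic endomorphisms are invertible (`isIso_of_epi`,
  `isIso_of_mono`, split forms), so one-sided inverses in `End X` are two-sided (`comp_eq_id_of_comp_eq_id`).
* §4 **Atiyah's Lemma 3**: the maps `endStep n : f ↦ αₙ ≫ f ≫ βₙ`, `End(Xₙ₊₁) → End(Xₙ)` are injective (`endStep_injective`); if
  `endStep n` is onto then `αₙ`, `βₙ` are invertible (`isIso_of_endStep_surjective` — `αₙ` is an epic split mono, `βₙ` a monic split epi,
  in ANY category), and conversely (`endStep_bijective_of_isIso`); hence **a bi-chain terminates iff the maps `endStep n` are eventually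
  bijective** (`eventuallyIso_iff_eventually_bijective_endStep`).
* §5 **Lemma 5.2 ∕ Atiyah's Corollary in the generality of the proof** (`bichainCondition_of_isArtinian_end`): in a `k`-linear category,
  an object whose endomorphism module `X ⟶ X` is an ARTINIAN `k`-module satisfies the bi-chain condition — the composite transfers
  `f ↦ γₙ ≫ f ≫ δₙ` (`Bichain.endTransfer n : End(Xₙ) →ₗ End(X₀)`, injective) have decreasing images in `End(X₀)`; when the image is
  stationary at `n`, `endStep n` is onto and §4 applies (no abelian hypothesis, and only the chain condition of `Hom(X,X)` is used).
  Printed forms: `bichainCondition_of_isFiniteLength_end` (Krause: «`Hom(X,X)` of finite length»), `bichainCondition_of_finite_end`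
  (Atiyah: finite-dimensional over a field; here a division ring).

NOT here (sibling files of this story): Lemma 5.1 (objects of finite length — artinian and noetherian — satisfy the condition),
Lemma 5.3 ∕ Atiyah's Lemmas 5–6 (Fitting), Prop. 5.4 ∕ Lemma 7 (indecomposable ⟺ local endomorphism ring), Thm. 5.5 ∕ Theorem 1
(Atiyah's Krull–Remak–Schmidt theorem).

## Mathlib ∕ Literature search

Mathlib: `Epi`, `Mono`, `IsSplitMono.mk'`, `IsSplitEpi.mk'`, `isIso_of_epi_of_isSplitMono`, `isIso_of_mono_of_isSplitEpi`, `IsZero.of_epi`,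
`IsZero.isIso`, `biprod.inl_fst`, `biproduct.ι_π_self`, `Linear.smul_comp`∕`comp_smul`, `IsArtinian.monotone_stabilizes`,
`LinearEquiv.isArtinian_iff`, `isFiniteLength_iff_isNoetherian_isArtinian`; `IsArtinianObject`∕`IsNoetherianObject` (chain conditions on
`Subobject X`) exist, but Mathlib has no bi-chain condition, no Hopfian objects and no Fitting lemma for categories
(`rg -il "bichain|bi-chain|hopfian" Mathlib/CategoryTheory` → nothing; «Fitting» only in unrelated docstrings).  Literature:
`rg -il "bichain|bi-chain" lean/Literature` → only the docstring quotation of Krause Prop. 5.4 in `CategoryTheory/Preadditive/IndecomposableLocalEnd`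
(g36, the ARTINIAN-`End` route to «indecomposable ⟺ local»); `Algebra/Module/FittingLemmaIndecomposable` is the MODULE case (Lam
(19.16)–(19.17)) on Mathlib's `LinearMap.eventually_isCompl_ker_pow_range_pow` — other carrier, not restated.

## References

* M. Atiyah, *On the Krull-Schmidt theorem with application to sheaves*, Bull. Soc. Math. France 84 (1956) 307–317: §3 «Chain conditions»
  (Definitions; Lemma 3; Corollary). [Atiyah1956]
* H. Krause, *Krull–Schmidt categories and projective covers*, Expo. Math. 33 (2015) 535–549, arXiv:1410.2822: §5 «Chain conditions»
  (the bi-chain condition; Lemma 5.2; proof of Thm. 5.5). [Krause2015KS]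

## Provenance

Lane `lit-hodgefound` (summit `HodgeConjecture`, Track 2 foundations library), seat `lit-hodgefound-p36` (literature-prover, generation 41,
row g41-#1); Krause materialised as `paper-arxiv-1410.2822` (p0010), Atiyah as `galaxy-pdf-4113901900` (numdam; pp. 3–4 of the scan =
pp. 309–310).
-/

open CategoryTheory CategoryTheory.Limits

namespace Literature.CategoryTheory.KrullSchmidt

universe w v u

variable {C : Type u} [Category.{v} C]

/-! ## §1 Bi-chains -/

/-- A **bi-chain** in a category: a sequence of morphisms `Xₙ —αₙ→ Xₙ₊₁ —βₙ→ Xₙ` (`n ≥ 0`) with every `αₙ` an epimorphism and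
every `βₙ` a monomorphism.  Atiyah: «A *bi-chain* of `𝔄` is a sequence of triples `{Aₙ, iₙ, pₙ}` with the following properties:
(i) `Aₙ ∈ 𝔄` (`n ≥ 0`), (ii) `iₙ : Aₙ → Aₙ₋₁` is a monomorphism (`n ≥ 1`), (ii)* `pₙ : Aₙ₋₁ → Aₙ` is an epimorphism (`n ≥ 1`).»
[cite: Atiyah1956, §3 Definition] [cite: Krause2015KS, §5 «The bi-chain condition»] -/
structure Bichain (C : Type u) [Category.{v} C] where
  /-- the objects `Xₙ` -/
  obj : ℕ → C
  /-- the epimorphisms `αₙ : Xₙ ⟶ Xₙ₊₁` -/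
  fwd : ∀ n, obj n ⟶ obj (n + 1)
  /-- the monomorphisms `βₙ : Xₙ₊₁ ⟶ Xₙ` -/
  bwd : ∀ n, obj (n + 1) ⟶ obj n
  epi_fwd : ∀ n, Epi (fwd n)
  mono_bwd : ∀ n, Mono (bwd n)

namespace Bichain

variable (B : Bichain C)

/-- Atiyah: «A bi-chain `{Aₙ, iₙ, pₙ}` is said to *terminate* if there exists an integer `N` such that, for all `n ≥ N`, `iₙ` and `pₙ`
are equivalences.» [cite: Atiyah1956, §3 Definition] [cite: Krause2015KS, §5 «The bi-chain condition»] -/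
def EventuallyIso (B : Bichain C) : Prop :=
  ∃ n₀ : ℕ, ∀ n, n₀ ≤ n → IsIso (B.fwd n) ∧ IsIso (B.bwd n)

/-- Unfolding `EventuallyIso`. [cite: Krause2015KS, §5 «The bi-chain condition»] -/
theorem eventuallyIso_iff : B.EventuallyIso ↔ ∃ n₀ : ℕ, ∀ n, n₀ ≤ n → IsIso (B.fwd n) ∧ IsIso (B.bwd n) :=
  Iff.rfl

/-- The bi-chain `X —a→ X₀ —b→ X` followed by `B`, for an epimorphism `a : X ⟶ X₀` and a monomorphism `b : X₀ ⟶ X` (used to move the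
bi-chain condition to direct summands). [cite: Krause2015KS, §5 «The bi-chain condition»] [cite: Krause2015KS, §5 Thm. 5.5 (proof)] -/
def cons (X : C) (a : X ⟶ B.obj 0) (b : B.obj 0 ⟶ X) (ha : Epi a) (hb : Mono b) : Bichain C where
  obj := fun n => Nat.casesOn n X fun m => B.obj m
  fwd := fun n => Nat.casesOn (motive := fun n => (Nat.casesOn n X fun m => B.obj m : C) ⟶ B.obj n) n a fun m => B.fwd m
  bwd := fun n => Nat.casesOn (motive := fun n => B.obj n ⟶ (Nat.casesOn n X fun m => B.obj m : C)) n b fun m => B.bwd m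
  epi_fwd := fun n => by
    cases n with
    | zero => exact ha
    | succ m => exact B.epi_fwd m
  mono_bwd := fun n => by
    cases n with
    | zero => exact hb
    | succ m => exact B.mono_bwd m

/-- The prepended bi-chain starts at `X`. [cite: Krause2015KS, §5 «The bi-chain condition»] -/
@[simp] theorem cons_obj_zero (X : C) (a : X ⟶ B.obj 0) (b : B.obj 0 ⟶ X) (ha : Epi a) (hb : Mono b) :
    (B.cons X a b ha hb).obj 0 = X := rfl

/-- From index `1` on the prepended bi-chain is `B`. [cite: Krause2015KS, §5 «The bi-chain condition»] -/
@[simp] theorem cons_obj_succ (X : C) (a : X ⟶ B.obj 0) (b : B.obj 0 ⟶ X) (ha : Epi a) (hb : Mono b) (m : ℕ) :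
    (B.cons X a b ha hb).obj (m + 1) = B.obj m := rfl

/-- The epimorphisms of the prepended bi-chain from index `1` on. [cite: Krause2015KS, §5 «The bi-chain condition»] -/
theorem cons_fwd_succ (X : C) (a : X ⟶ B.obj 0) (b : B.obj 0 ⟶ X) (ha : Epi a) (hb : Mono b) (m : ℕ) :
    (B.cons X a b ha hb).fwd (m + 1) = B.fwd m := rfl

/-- The monomorphisms of the prepended bi-chain from index `1` on. [cite: Krause2015KS, §5 «The bi-chain condition»] -/
theorem cons_bwd_succ (X : C) (a : X ⟶ B.obj 0) (b : B.obj 0 ⟶ X) (ha : Epi a) (hb : Mono b) (m : ℕ) :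
    (B.cons X a b ha hb).bwd (m + 1) = B.bwd m := rfl

/-- If the extended bi-chain terminates, so does the original one. [cite: Krause2015KS, §5 «The bi-chain condition»] -/
theorem eventuallyIso_of_cons {X : C} {a : X ⟶ B.obj 0} {b : B.obj 0 ⟶ X} {ha : Epi a} {hb : Mono b}
    (h : (B.cons X a b ha hb).EventuallyIso) : B.EventuallyIso := by
  obtain ⟨n₀, hn₀⟩ := h
  refine ⟨n₀, fun n hn => ?_⟩
  have := hn₀ (n + 1) (by omega)
  exact this

/-- The constant bi-chain `X —a→ X —b→ X —a→ ⋯` on one object, for an epimorphism `a` and a monomorphism `b` of `X`. [cite: Krause2015KS, §5 «The bi-chain condition»] -/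
def const (X : C) (a b : X ⟶ X) (ha : Epi a) (hb : Mono b) : Bichain C where
  obj := fun _ => X
  fwd := fun _ => a
  bwd := fun _ => b
  epi_fwd := fun _ => ha
  mono_bwd := fun _ => hb

/-- The composite epimorphisms `γₙ = αₙ₋₁ ⋯ α₁ α₀ : X₀ ⟶ Xₙ` of a bi-chain (Krause, proof of Lemma 5.1: «`Ker(αₙ … α₁ α₀)`»).
[cite: Krause2015KS, §5 Lemma 5.1 (proof)] -/
def fwdComp (B : Bichain C) : ∀ n, B.obj 0 ⟶ B.obj n
  | 0 => 𝟙 (B.obj 0)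
  | n + 1 => fwdComp B n ≫ B.fwd n

/-- The composite monomorphisms `δₙ = β₀ β₁ ⋯ βₙ₋₁ : Xₙ ⟶ X₀` of a bi-chain (Krause, proof of Lemma 5.1: «`Im(β₀ β₁ … βₙ)`»).
[cite: Krause2015KS, §5 Lemma 5.1 (proof)] -/
def bwdComp (B : Bichain C) : ∀ n, B.obj n ⟶ B.obj 0
  | 0 => 𝟙 (B.obj 0)
  | n + 1 => B.bwd n ≫ bwdComp B n

/-- `γ₀ = 𝟙`. [cite: Krause2015KS, §5 Lemma 5.1 (proof)] -/
@[simp] theorem fwdComp_zero : B.fwdComp 0 = 𝟙 (B.obj 0) := rfl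

/-- `γₙ₊₁ = αₙ γₙ`. [cite: Krause2015KS, §5 Lemma 5.1 (proof)] -/
@[simp] theorem fwdComp_succ (n : ℕ) : B.fwdComp (n + 1) = B.fwdComp n ≫ B.fwd n := rfl

/-- `δ₀ = 𝟙`. [cite: Krause2015KS, §5 Lemma 5.1 (proof)] -/
@[simp] theorem bwdComp_zero : B.bwdComp 0 = 𝟙 (B.obj 0) := rfl

/-- `δₙ₊₁ = δₙ βₙ`. [cite: Krause2015KS, §5 Lemma 5.1 (proof)] -/
@[simp] theorem bwdComp_succ (n : ℕ) : B.bwdComp (n + 1) = B.bwd n ≫ B.bwdComp n := rfl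

/-- The composites `γₙ` are epimorphisms. [cite: Krause2015KS, §5 Lemma 5.1 (proof)] -/
theorem epi_fwdComp (B : Bichain C) : ∀ n, Epi (B.fwdComp n)
  | 0 => by rw [fwdComp_zero]; infer_instance
  | n + 1 => by
    rw [fwdComp_succ]
    haveI := epi_fwdComp B n
    haveI := B.epi_fwd n
    exact epi_comp _ _

/-- The composites `δₙ` are monomorphisms. [cite: Krause2015KS, §5 Lemma 5.1 (proof)] -/
theorem mono_bwdComp (B : Bichain C) : ∀ n, Mono (B.bwdComp n)
  | 0 => by rw [bwdComp_zero]; infer_instance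
  | n + 1 => by
    rw [bwdComp_succ]
    haveI := mono_bwdComp B n
    haveI := B.mono_bwd n
    exact mono_comp _ _

end Bichain

/-! ## §2 The bi-chain condition -/

/-- Krause: «The object `X` satisfies the **bi-chain condition** if for every bi-chain `Xₙ —αₙ→ Xₙ₊₁ —βₙ→ Xₙ` (`n ≥ 0`) with `X = X₀`
there exists an integer `n₀` such that `αₙ` and `βₙ` are invertible for all `n ≥ n₀`.»  (The equality `X = X₀` is read as an
isomorphism `X ≅ X₀`, which makes the condition invariant under isomorphism.  Atiyah states the condition for the whole category:
«The bi-chain condition holds in `𝔄` if every bi-chain of `𝔄` terminates»; the object-wise form is Krause's.)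
[cite: Krause2015KS, §5 «The bi-chain condition»] [cite: Atiyah1956, §3 Definition] -/
def BichainCondition (X : C) : Prop :=
  ∀ B : Bichain C, Nonempty (X ≅ B.obj 0) → B.EventuallyIso

/-- Unfolding `BichainCondition`. [cite: Krause2015KS, §5 «The bi-chain condition»] -/
theorem bichainCondition_iff (X : C) :
    BichainCondition X ↔ ∀ B : Bichain C, Nonempty (X ≅ B.obj 0) → B.EventuallyIso :=
  Iff.rfl

namespace BichainCondition

variable {X Y : C}

/-- The bi-chain condition is invariant under isomorphism. [cite: Krause2015KS, §5 «The bi-chain condition»] -/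
theorem of_iso (h : BichainCondition X) (e : X ≅ Y) : BichainCondition Y :=
  fun B ⟨i⟩ => h B ⟨e ≪≫ i⟩

/-- Isomorphic objects satisfy the bi-chain condition simultaneously. [cite: Krause2015KS, §5 «The bi-chain condition»] -/
theorem iff_of_iso (e : X ≅ Y) : BichainCondition X ↔ BichainCondition Y :=
  ⟨fun h => h.of_iso e, fun h => h.of_iso e.symm⟩

/-- **Direct summands (retracts) of an object satisfying the bi-chain condition satisfy it** (Krause, proof of Thm. 5.5: «any
direct summand of `X` satisfies the bi-chain condition»): prepend `X —π→ Y —ι→ X` to a bi-chain starting at `Y`.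
[cite: Krause2015KS, §5 Thm. 5.5 (proof)] -/
theorem of_retract (h : BichainCondition X) (ι : Y ⟶ X) (π : X ⟶ Y) (hιπ : ι ≫ π = 𝟙 Y) : BichainCondition Y := by
  intro B ⟨e⟩
  haveI : IsSplitEpi π := IsSplitEpi.mk' ⟨ι, hιπ⟩
  haveI : IsSplitMono ι := IsSplitMono.mk' ⟨π, hιπ⟩
  haveI : Epi (π ≫ e.hom) := epi_comp _ _
  haveI : Mono (e.inv ≫ ι) := mono_comp _ _
  exact B.eventuallyIso_of_cons (h (B.cons X (π ≫ e.hom) (e.inv ≫ ι) inferInstance inferInstance) ⟨Iso.refl X⟩)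

section Zero

variable [HasZeroMorphisms C]

/-- A zero object satisfies the bi-chain condition (all objects of a bi-chain starting at `0` are zero). [cite: Krause2015KS, §5 «The bi-chain condition»] -/
theorem of_isZero (hX : IsZero X) : BichainCondition X := by
  intro B ⟨e⟩
  have hobj : ∀ n, IsZero (B.obj n) := by
    intro n
    induction n with
    | zero => exact hX.of_iso e.symm
    | succ n ih =>
      haveI := B.epi_fwd n
      exact IsZero.of_epi (B.fwd n) ih
  exact ⟨0, fun n _ => ⟨(hobj n).isIso (hobj (n + 1)) _, (hobj (n + 1)).isIso (hobj n) _⟩⟩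

variable [HasBinaryBiproducts C]

/-- Summands of a binary biproduct decomposition inherit the bi-chain condition. [cite: Krause2015KS, §5 Thm. 5.5 (proof)] -/
theorem of_iso_biprod_left {Y Z : C} (h : BichainCondition X) (i : X ≅ Y ⊞ Z) : BichainCondition Y :=
  h.of_retract (biprod.inl ≫ i.inv) (i.hom ≫ biprod.fst) (by simp)

/-- Summands of a binary biproduct decomposition inherit the bi-chain condition (right summand). [cite: Krause2015KS, §5 Thm. 5.5 (proof)] -/
theorem of_iso_biprod_right {Y Z : C} (h : BichainCondition X) (i : X ≅ Y ⊞ Z) : BichainCondition Z :=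
  h.of_retract (biprod.inr ≫ i.inv) (i.hom ≫ biprod.snd) (by simp)

end Zero

section Biproduct

variable [HasZeroMorphisms C] [HasFiniteBiproducts C]

/-- Summands of a finite biproduct decomposition inherit the bi-chain condition. [cite: Krause2015KS, §5 Thm. 5.5 (proof)] -/
theorem of_iso_biproduct {ι : Type} [Finite ι] {Xs : ι → C} (h : BichainCondition X) (i : X ≅ ⨁ Xs) (j : ι) :
    BichainCondition (Xs j) := by
  classical
  exact h.of_retract (biproduct.ι Xs j ≫ i.inv) (i.hom ≫ biproduct.π Xs j) (by simp)

end Biproduct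

/-! ## §3 Objects satisfying the bi-chain condition are Hopfian and co-Hopfian -/

/-- An EPIMORPHIC endomorphism of an object satisfying the bi-chain condition is invertible (apply the condition to the constant
bi-chain `X —φ→ X —𝟙→ X —φ→ ⋯`). [cite: Krause2015KS, §5 «The bi-chain condition»] -/
theorem isIso_of_epi (h : BichainCondition X) (φ : X ⟶ X) [Epi φ] : IsIso φ := by
  obtain ⟨n₀, hn₀⟩ := h (Bichain.const X φ (𝟙 X) inferInstance inferInstance) ⟨Iso.refl X⟩
  exact (hn₀ n₀ le_rfl).1

/-- A MONOMORPHIC endomorphism of an object satisfying the bi-chain condition is invertible (the constant bi-chain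
`X —𝟙→ X —φ→ X —𝟙→ ⋯`). [cite: Krause2015KS, §5 «The bi-chain condition»] -/
theorem isIso_of_mono (h : BichainCondition X) (φ : X ⟶ X) [Mono φ] : IsIso φ := by
  obtain ⟨n₀, hn₀⟩ := h (Bichain.const X (𝟙 X) φ inferInstance inferInstance) ⟨Iso.refl X⟩
  exact (hn₀ n₀ le_rfl).2

/-- Hence one-sided inverses in `End X` are two-sided: `φ ≫ ψ = 𝟙 ⟹ ψ ≫ φ = 𝟙`. [cite: Krause2015KS, §5 «The bi-chain condition»] -/
theorem comp_eq_id_of_comp_eq_id (h : BichainCondition X) {φ ψ : X ⟶ X} (hφψ : φ ≫ ψ = 𝟙 X) : ψ ≫ φ = 𝟙 X := by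
  haveI : IsSplitMono φ := IsSplitMono.mk' ⟨ψ, hφψ⟩
  haveI : IsIso φ := h.isIso_of_mono φ
  have : ψ = inv φ := by
    rw [← cancel_epi φ, hφψ, IsIso.hom_inv_id]
  rw [this, IsIso.inv_hom_id]

/-- A split monomorphic endomorphism of an object satisfying the bi-chain condition is an isomorphism. [cite: Krause2015KS, §5 «The bi-chain condition»] -/
theorem isIso_of_isSplitMono (h : BichainCondition X) (φ : X ⟶ X) [IsSplitMono φ] : IsIso φ :=
  h.isIso_of_mono φ

/-- A split epimorphic endomorphism of an object satisfying the bi-chain condition is an isomorphism. [cite: Krause2015KS, §5 «The bi-chain condition»] -/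
theorem isIso_of_isSplitEpi (h : BichainCondition X) (φ : X ⟶ X) [IsSplitEpi φ] : IsIso φ :=
  h.isIso_of_epi φ

end BichainCondition

/-! ## §4 Atiyah's Lemma 3: a bi-chain terminates iff the chain `Hom(Xₙ₊₁,Xₙ₊₁) ↪ Hom(Xₙ,Xₙ)` does -/

namespace Bichain

variable (B : Bichain C)

/-- Atiyah's `H(pₙ, iₙ) : H(Aₙ,Aₙ) → H(Aₙ₋₁,Aₙ₋₁)`, `φ ↦ iₙ φ pₙ` (Krause: «each pair `αₙ, βₙ` induces a monomorphism
`Hom(Xₙ₊₁,Xₙ₊₁) → Hom(Xₙ,Xₙ)`»): `f ↦ αₙ ≫ f ≫ βₙ`. [cite: Atiyah1956, §3 Lemma 3] [cite: Krause2015KS, §5 Lemma 5.2 (proof)] -/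
def endStep (n : ℕ) (f : B.obj (n + 1) ⟶ B.obj (n + 1)) : B.obj n ⟶ B.obj n :=
  B.fwd n ≫ f ≫ B.bwd n

/-- Unfolding `endStep`. [cite: Atiyah1956, §3 Lemma 3] -/
theorem endStep_apply (n : ℕ) (f : B.obj (n + 1) ⟶ B.obj (n + 1)) : B.endStep n f = B.fwd n ≫ f ≫ B.bwd n := rfl

/-- «`H(pₙ, iₙ)` is a monomorphism» (`αₙ` is epi, `βₙ` is mono). [cite: Atiyah1956, §3 (before Lemma 3)] [cite: Krause2015KS, §5 Lemma 5.2 (proof)] -/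
theorem endStep_injective (n : ℕ) : Function.Injective (B.endStep n) := by
  intro f g hfg
  haveI := B.epi_fwd n
  haveI := B.mono_bwd n
  simpa [endStep_apply, cancel_epi, cancel_mono] using hfg

/-- **Atiyah's Lemma 3 (⟸ at one index)**: if `f ↦ αₙ ≫ f ≫ βₙ` is onto, then `𝟙 = αₙ φ βₙ` for some `φ`, «but this implies that `iₙ` is
an epimorphism and `pₙ` a monomorphism. Hence both are equivalences» — here: `αₙ` is an epic split mono and `βₙ` a monic split epi, so
both are isomorphisms, in any category. [cite: Atiyah1956, §3 Lemma 3] [cite: Krause2015KS, §5 Lemma 5.2 (proof)] -/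
theorem isIso_of_endStep_surjective (n : ℕ) (hs : Function.Surjective (B.endStep n)) : IsIso (B.fwd n) ∧ IsIso (B.bwd n) := by
  obtain ⟨f, hf⟩ := hs (𝟙 _)
  rw [endStep_apply] at hf
  haveI := B.epi_fwd n
  haveI := B.mono_bwd n
  haveI : IsSplitMono (B.fwd n) := IsSplitMono.mk' ⟨f ≫ B.bwd n, by simpa [Category.assoc] using hf⟩
  haveI : IsSplitEpi (B.bwd n) := IsSplitEpi.mk' ⟨B.fwd n ≫ f, by simpa [Category.assoc] using hf⟩
  exact ⟨isIso_of_epi_of_isSplitMono _, isIso_of_mono_of_isSplitEpi _⟩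

/-- **Atiyah's Lemma 3 (⟹ at one index)**: if `αₙ` and `βₙ` are invertible then `f ↦ αₙ ≫ f ≫ βₙ` is bijective («in fact we have
`H(pₙ,iₙ) H(pₙ⁻¹,iₙ⁻¹) = 1`»). [cite: Atiyah1956, §3 Lemma 3] -/
theorem endStep_bijective_of_isIso (n : ℕ) [IsIso (B.fwd n)] [IsIso (B.bwd n)] : Function.Bijective (B.endStep n) := by
  refine ⟨B.endStep_injective n, fun g => ⟨inv (B.fwd n) ≫ g ≫ inv (B.bwd n), ?_⟩⟩
  simp [endStep_apply]

/-- **Atiyah's Lemma 3**: «Let `{Aₙ, iₙ, pₙ}` be a bi-chain of `𝔄`. Then `{Aₙ, iₙ, pₙ}` terminates if and only if the descending chain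
`{H(Aₙ,Aₙ), H(pₙ,iₙ)}` terminates» (i.e. the injections `H(pₙ,iₙ)` are isomorphisms for all sufficiently large `n`).
[cite: Atiyah1956, §3 Lemma 3] -/
theorem eventuallyIso_iff_eventually_bijective_endStep :
    B.EventuallyIso ↔ ∃ n₀ : ℕ, ∀ n, n₀ ≤ n → Function.Bijective (B.endStep n) := by
  constructor
  · rintro ⟨n₀, hn₀⟩
    refine ⟨n₀, fun n hn => ?_⟩
    obtain ⟨h1, h2⟩ := hn₀ n hn
    exact B.endStep_bijective_of_isIso n
  · rintro ⟨n₀, hn₀⟩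
    exact ⟨n₀, fun n hn => B.isIso_of_endStep_surjective n (hn₀ n hn).2⟩

end Bichain

/-! ## §5 Lemma 5.2 ∕ Atiyah's Corollary: `Hom`-finite objects satisfy the bi-chain condition -/

section HomFinite

variable [Preadditive C] {k : Type w} [Semiring k] [Linear k C]

/-- The `k`-linear map `End(Xₙ) → End(X₀)`, `f ↦ γₙ ≫ f ≫ δₙ` (conjugation by the composite epimorphism `γₙ : X₀ ↠ Xₙ` and the
composite monomorphism `δₙ : Xₙ ↣ X₀` of a bi-chain); Krause's «each pair `αₙ, βₙ` induces a monomorphism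
`Hom(Xₙ₊₁,Xₙ₊₁) → Hom(Xₙ,Xₙ)`», composed down to `X₀`. [cite: Krause2015KS, §5 Lemma 5.2 (proof)] -/
def Bichain.endTransfer (B : Bichain C) (n : ℕ) : (B.obj n ⟶ B.obj n) →ₗ[k] (B.obj 0 ⟶ B.obj 0) where
  toFun f := B.fwdComp n ≫ f ≫ B.bwdComp n
  map_add' f g := by simp [Preadditive.add_comp, Preadditive.comp_add]
  map_smul' r f := by simp [Linear.smul_comp, Linear.comp_smul]

/-- Unfolding `endTransfer`. [cite: Krause2015KS, §5 Lemma 5.2 (proof)] -/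
theorem Bichain.endTransfer_apply (B : Bichain C) (n : ℕ) (f : B.obj n ⟶ B.obj n) :
    B.endTransfer (k := k) n f = B.fwdComp n ≫ f ≫ B.bwdComp n := rfl

/-- Krause: «each pair `αₙ, βₙ` induces a monomorphism `Hom(Xₙ₊₁,Xₙ₊₁) → Hom(Xₙ,Xₙ)`» — the transfer maps are injective (`γₙ` epi, `δₙ`
mono). [cite: Krause2015KS, §5 Lemma 5.2 (proof)] -/
theorem Bichain.endTransfer_injective (B : Bichain C) (n : ℕ) : Function.Injective (B.endTransfer (k := k) n) := by
  intro f g hfg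
  haveI := B.epi_fwdComp n
  haveI := B.mono_bwdComp n
  simpa [Bichain.endTransfer_apply, cancel_epi, cancel_mono] using hfg

/-- The transfer from `Xₙ₊₁` factors through the transfer from `Xₙ` via `f ↦ αₙ ≫ f ≫ βₙ`. [cite: Krause2015KS, §5 Lemma 5.2 (proof)] -/
theorem Bichain.endTransfer_succ (B : Bichain C) (n : ℕ) (f : B.obj (n + 1) ⟶ B.obj (n + 1)) :
    B.endTransfer (k := k) (n + 1) f = B.endTransfer (k := k) n (B.fwd n ≫ f ≫ B.bwd n) := by
  simp [Bichain.endTransfer_apply, Category.assoc]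

/-- The images of the transfer maps in `End(X₀)` decrease. [cite: Krause2015KS, §5 Lemma 5.2 (proof)] -/
theorem Bichain.range_endTransfer_succ_le (B : Bichain C) (n : ℕ) :
    LinearMap.range (B.endTransfer (k := k) (n + 1)) ≤ LinearMap.range (B.endTransfer (k := k) n) := by
  rintro _ ⟨f, rfl⟩
  exact ⟨B.fwd n ≫ f ≫ B.bwd n, (B.endTransfer_succ n f).symm⟩

/-- **Krause Lemma 5.2, in the generality its proof gives**: in a `k`-linear category, an object `X` whose endomorphism module
`Hom(X,X)` is an ARTINIAN `k`-module satisfies the bi-chain condition.  (Krause: «An object of a Hom-finite abelian category satisfies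
the bi-chain condition»; his proof: the pairs `αₙ, βₙ` induce monomorphisms `Hom(Xₙ₊₁,Xₙ₊₁) → Hom(Xₙ,Xₙ)`; once such a map is
bijective, `αₙ` is a (split) monomorphism and `βₙ` a (split) epimorphism, hence both are invertible — an epic split mono and a monic
split epi are isomorphisms in any category, so neither abelianness nor finite length of all `Hom`-modules is needed, only the descending
chain condition in `Hom(X,X)`, into which all the `Hom(Xₙ,Xₙ)` embed.)  Atiyah's Corollary to Lemma 3: «Let `𝔄` be an exact category with
the further structure: a. For all pairs `A, B ∈ 𝔄`, `H(A,B)` is a finite-dimensional vector space over a field `k`; b. For all pairs `φ, ψ`,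
`H(φ,ψ)` is a `k`-homomorphism. Then the bi-chain condition holds in `𝔄`. *Proof.* This follows immediately from lemma 3, since every
descending chain of finite-dimensional vector spaces necessarily terminates.» [cite: Krause2015KS, §5 Lemma 5.2] [cite: Atiyah1956, §3 Corollary] -/
theorem bichainCondition_of_isArtinian_end (X : C) [IsArtinian k (X ⟶ X)] : BichainCondition X := by
  intro B ⟨e⟩
  -- transport the chain condition to `End (B.obj 0)`
  let T : (B.obj 0 ⟶ B.obj 0) ≃ₗ[k] (X ⟶ X) :=
    { toFun := fun f => e.hom ≫ f ≫ e.inv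
      invFun := fun g => e.inv ≫ g ≫ e.hom
      map_add' := fun f g => by simp [Preadditive.add_comp, Preadditive.comp_add]
      map_smul' := fun r f => by simp [Linear.smul_comp, Linear.comp_smul]
      left_inv := fun f => by simp
      right_inv := fun g => by simp }
  haveI : IsArtinian k (B.obj 0 ⟶ B.obj 0) := LinearEquiv.isArtinian_iff T |>.2 inferInstance
  -- the descending chain of the images of `End(Xₙ)` in `End(X₀)`
  let S : ℕ → Submodule k (B.obj 0 ⟶ B.obj 0) := fun n => LinearMap.range (B.endTransfer (k := k) n)
  have hS : Antitone S := antitone_nat_of_succ_le fun n => B.range_endTransfer_succ_le n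
  obtain ⟨n₀, hn₀⟩ := IsArtinian.monotone_stabilizes (R := k) (M := (B.obj 0 ⟶ B.obj 0))
    ⟨fun n => OrderDual.toDual (S n), fun a b hab => OrderDual.toDual_le_toDual.2 (hS hab)⟩
  refine ⟨n₀, fun n hn => ?_⟩
  have hSn : S (n + 1) = S n := by
    have h1 := hn₀ n hn
    have h2 := hn₀ (n + 1) (by omega)
    change OrderDual.toDual (S n₀) = OrderDual.toDual (S n) at h1
    change OrderDual.toDual (S n₀) = OrderDual.toDual (S (n + 1)) at h2
    exact OrderDual.toDual.injective (h2.symm.trans h1)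
  -- `𝟙 ∈ S n = S (n+1)` gives `f` with `αₙ ≫ f ≫ βₙ = 𝟙`
  have hmem : B.endTransfer (k := k) n (𝟙 _) ∈ S (n + 1) := hSn ▸ ⟨𝟙 _, rfl⟩
  obtain ⟨f, hf⟩ := hmem
  rw [B.endTransfer_succ] at hf
  have hf' : B.fwd n ≫ f ≫ B.bwd n = 𝟙 _ := B.endTransfer_injective n hf
  haveI := B.epi_fwd n
  haveI := B.mono_bwd n
  haveI : IsSplitMono (B.fwd n) := IsSplitMono.mk' ⟨f ≫ B.bwd n, by simpa [Category.assoc] using hf'⟩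
  haveI : IsSplitEpi (B.bwd n) := IsSplitEpi.mk' ⟨B.fwd n ≫ f, by simpa [Category.assoc] using hf'⟩
  exact ⟨isIso_of_epi_of_isSplitMono _, isIso_of_mono_of_isSplitEpi _⟩

/-- Krause Lemma 5.2 as printed («Hom-finite»: `Hom(X,X)` a `k`-module of finite length). [cite: Krause2015KS, §5 Lemma 5.2] -/
theorem bichainCondition_of_isFiniteLength_end {k : Type w} [Ring k] [Linear k C] (X : C) (hX : IsFiniteLength k (X ⟶ X)) :
    BichainCondition X := by
  haveI := (isFiniteLength_iff_isNoetherian_isArtinian.1 hX).2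
  exact bichainCondition_of_isArtinian_end (k := k) X

/-- In particular every object with finite-dimensional endomorphism algebra over a division ring (e.g. of a `Hom`-finite `k`-linear
category over a field) satisfies the bi-chain condition — Atiyah's Corollary, object-wise. [cite: Atiyah1956, §3 Corollary]
[cite: Krause2015KS, §5 Lemma 5.2] -/
theorem bichainCondition_of_finite_end {k : Type w} [DivisionRing k] [Linear k C] (X : C) [Module.Finite k (X ⟶ X)] :
    BichainCondition X :=
  bichainCondition_of_isArtinian_end (k := k) X

end HomFinite

end Literature.CategoryTheory.KrullSchmidt
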